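import Mathlib
import HarnessLib
import Summits.HubbardSuperconductivity.HubbardSuperconductivity.Theorems.KLProgrammeKLRegimeSplitLegDressingRev
import Summits.HubbardSuperconductivity.HubbardSuperconductivity.Theorems.KLProgrammeKLRegimeEngineV8LegDressThreshold
import Summits.HubbardSuperconductivity.HubbardSuperconductivity.Theorems.KLProgrammeKLRegimeEngineSelfEnergySymmetric
import Summits.HubbardSuperconductivity.HubbardSuperconductivity.Theorems.KLProgrammeKLRegimeSplitBundleV16

/-!
# Route `KLProgramme` — gen-6 ENGINE child on `klPredsV16` (successor of stmt-HubbardSuperconductivity-19918), `stub_engine_step_values`, (E2-v10)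
# leg-dress line: the plain-carrier leg-dress term under EXACTLY the stub's binders — `P.WF`, `R.WF2`, `klBetaMin ≤ β`, `1 ≤ n ≤ n_β + 1`,
# `HistP klPredsV16 … n`, `Q := klEngQ5 P R` (cell gate-hubbard-kl, seat hubbard-kl-k3c2-p3 g3, row «leg-dress bar»; door over
# `…SplitLegDressingRev` + `…EngineV8LegDressThreshold` + p2 g9's `…SplitBundleV16`)

* `klld_slots_of_histP_V16` — the history at `j = n − 1` hands the two slots the per-leg size reads: `RenormalisedAtF … R (n−1)` (renorm slot) and
  `TwoLegSlopes R … (n−1)` (third conjunct of `TwoLegCoreTD` inside `TwoLegStepV16 (n−1)`); (E0) is `selfEnergySymmetric_all` (p455831).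
* **`klld_legDress_le_legDressBarQ2_of_histP_V16`** — for any value `v ≤ Klam·|U|`, any `±ω₀` tags `ω`, legs `k`, spins/charges:
  `(βL²)⁻¹·(2v·Σ_i ‖slice entry(ω_i,k_i)‖·‖Σ_{n−1}(ω_i,k_i,σ_i)‖) ≤ legDressBarQ2 G P (klEngQ5 P R) U n (legSliceCountT … n k)`, NO threshold
  hypothesis left (`legDress_threshold_klEngQ5`).  `G` is arbitrary (`legDressBarQ2` does not read it), so `G := klEngGeo5` is an instance.
Proved; no definitions; slot texts untouched.
-/

noncomputable section

namespace Summit.HubbardSuperconductivity.HubbardSuperconductivity.Theorems.KLRegimeSplit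

set_option linter.dupNamespace false -- summit = problem name (single-conjunct summit), D-0017

open Real Finset Literature.MathematicalPhysics.QuantumLattice Literature.Probability.LatticeModels
open Summit.HubbardSuperconductivity.HubbardSuperconductivity.Theorems.KLProgrammeLegKernels
open Summit.HubbardSuperconductivity.HubbardSuperconductivity.Theorems.EngineV8

section Model

variable {L M : ℕ} [NeZero L] [NeZero M] {G : GeoConsts} {P : SplitConsts} {Q : EngConsts} {R : RenConsts} {β U μ : ℝ}
  {K : TrigPolyC4v} {n : ℕ}

/-- **The two slots the leg-dress size reads, from the V16 history at `j = n − 1`.** -/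
theorem klld_slots_of_histP_V16 (h : HistP klPredsV16 L M G P Q R β U μ K n) (hn : 1 ≤ n) :
    RenormalisedAtF L M β U μ K R (n - 1) ∧ TwoLegSlopes L M R β U μ K (n - 1) := by
  have hj : n - 1 < n := by omega
  obtain ⟨-, hren, -, htl⟩ := histP_V16_apply h hj
  exact ⟨hren, (twoLegCoreTD_of_twoLegStepV16 htl).2.2⟩

/-- **The (E2-v10) leg-dress budget term under the stub's binders** (`stub_engine_step_values` of the gen-6 engine skeleton, `Q := klEngQ5 P R`):
for `1 ≤ n ≤ n_β + 1`, `P.WF`, `R.WF2`, `klBetaMin ≤ β`, the history `HistP klPredsV16 … n`, any value `v ≤ Klam·|U|` (`v ≥ 0`), any frequency tags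
`ω_i ∈ {ω₀, −ω₀}`, legs `k`, spins `σ`, charge labels `c, c'`:
`(βL²)⁻¹·(2v·Σ_i ‖(C^K_{>Λ_n} − C^K_{>Λ_{n−1}})((ω_i,k_i,σ_i,c_i),(ω_i,k_i,σ_i,c'_i))‖·‖Σ_{n−1}(ω_i,k_i,σ_i)‖) ≤ legDressBarQ2 G P (klEngQ5 P R) U n (legSliceCountT … n k)`. -/
theorem klld_legDress_le_legDressBarQ2_of_histP_V16 (hP : P.WF) (hR : R.WF2) (hβ : klBetaMin ≤ β) (hn1 : 1 ≤ n)
    (hn : n ≤ nScales β + 1) (h : HistP klPredsV16 L M G P (klEngQ5 P R) R β U μ K n) {v : ℝ} (hv0 : 0 ≤ v) (hv : v ≤ P.Klam * |U|)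
    {ω : Fin 4 → MatsubaraIdx M} (hω : ∀ i, ω i = omega0 M ∨ ω i = (omega0 M).rev) (k : Fin 4 → TorusSite 2 L)
    (σ c c' : Fin 4 → Fin 2) :
    (β * (L : ℝ) ^ 2)⁻¹ * (2 * v *
        ∑ i : Fin 4, ‖hubbardCovSliceCT L M β μ 0 K (klScale klE0 n) (klScale klE0 (n - 1)) (((ω i, k i), σ i), c i)
            (((ω i, k i), σ i), c' i)‖ * ‖klSelfEnergy L M β U μ K klE0 (n - 1) (ω i, k i) (σ i)‖) ≤
      legDressBarQ2 G P (klEngQ5 P R) U n (legSliceCountT L β μ K n k) := by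
  obtain ⟨hren, hsl⟩ := klld_slots_of_histP_V16 h hn1
  have hE0 : SelfEnergySymmetric L M β U μ K (n - 1) := selfEnergySymmetric_all (L := L) (M := M) β U μ K (n - 1)
  have hK : 0 ≤ P.Klam := zero_le_one.trans hP.1
  have hQ0 : 0 ≤ (klEngQ5 P R).CR := (klEngQ5_wf P R).2.1
  exact klld_legDress_tagged_le_legDressBarQ2 hβ hR.2.1.le hR.2.2.le hn1 hn hE0 hren hsl G hK hQ0 (legDress_threshold_klEngQ5 hP R)
    hv0 hv hω k σ c c'

end Model

end Summit.HubbardSuperconductivity.HubbardSuperconductivity.Theorems.KLRegimeSplit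

end
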